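import Mathlib.RingTheory.KrullDimension.Module
import Mathlib.RingTheory.KrullDimension.NonZeroDivisors
import Mathlib.RingTheory.Support
import Mathlib.RingTheory.Localization.Ideal
import Mathlib.RingTheory.Localization.Finiteness
import Mathlib.Order.KrullDimension
import HarnessLib

/-!
# `dim Supp M_𝔭 + dim R/𝔭 ≤ dim Supp M`

Topic: `Literature/AlgebraicGeometry/Resolution` (dimension bookkeeping for globalizing the
`Ext`-annihilator ideal `𝔠` of Theorem A, `ExtAnnihilatorLocalization.lean`: the local ideal at
`𝔭` uses the index window `(ht 𝔭 - dim M_𝔭, …]`, which must contain the global one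
`(dim S - dim M, …]`).

* `annihilator_map_le_annihilator_localizedModule` — `(Ann_R M) R_𝔭 ⊆ Ann_{R_𝔭} M_𝔭`.
* `supportDim_localizedModule_add_ringKrullDim_quotient_le` — for a finite module `M` over a
  commutative ring and a prime `𝔭 ⊇ Ann M`:
  `dim Supp_{R_𝔭} M_𝔭 + dim R/𝔭 ≤ dim Supp_R M` (a chain of primes of `Supp M_𝔭` contracts to a
  chain in `Supp M` below `𝔭`, a chain of `Spec R/𝔭` is a chain in `Supp M` above `𝔭`; concatenate:
  `height + coheight ≤ krullDim`, [Matsumura1987, §5 p. 31]).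

[cite: Matsumura1987, §5 (dimension of modules, p. 31); StacksProject, Tag 00L4]
-/

noncomputable section

open Module Order

universe u v

namespace Literature.AlgebraicGeometry.Resolution

variable {R : Type u} [CommRing R] {M : Type v} [AddCommGroup M] [Module R M]
variable (𝔭 : Ideal R) [𝔭.IsPrime]

/-- `(Ann_R M) · R_𝔭 ⊆ Ann_{R_𝔭} M_𝔭`. [folklore] -/
theorem annihilator_map_le_annihilator_localizedModule :
    (Module.annihilator R M).map (algebraMap R (Localization.AtPrime 𝔭)) ≤
      Module.annihilator (Localization.AtPrime 𝔭) (LocalizedModule 𝔭.primeCompl M) := by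
  refine Ideal.map_le_iff_le_comap.mpr fun z hz => ?_
  rw [Ideal.mem_comap, Module.mem_annihilator]
  intro m
  induction m using LocalizedModule.induction_on with
  | h m s =>
    rw [algebraMap_smul, LocalizedModule.smul'_mk, Module.mem_annihilator.mp hz m,
      LocalizedModule.zero_mk]

/-- A prime of `R_𝔭` contracts into `𝔭`. [folklore] -/
theorem comap_le_of_isPrime (𝔮 : Ideal (Localization.AtPrime 𝔭)) [𝔮.IsPrime] :
    𝔮.comap (algebraMap R (Localization.AtPrime 𝔭)) ≤ 𝔭 := by
  intro x hx
  by_contra hx𝔭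
  have hu : IsUnit (algebraMap R (Localization.AtPrime 𝔭) x) :=
    IsLocalization.map_units _ (⟨x, hx𝔭⟩ : 𝔭.primeCompl)
  exact Ideal.IsPrime.ne_top ‹𝔮.IsPrime› (Ideal.eq_top_of_isUnit_mem _ hx hu)

variable [Module.Finite R M]

/-- **`dim Supp M_𝔭 + dim R/𝔭 ≤ dim Supp M`** for a finite module `M` and a prime `𝔭 ⊇ Ann M`.
[cite: Matsumura1987, §5 p. 31] -/
theorem supportDim_localizedModule_add_ringKrullDim_quotient_le
    (h𝔭 : Module.annihilator R M ≤ 𝔭) :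
    Module.supportDim (Localization.AtPrime 𝔭) (LocalizedModule 𝔭.primeCompl M) +
        ringKrullDim (R ⧸ 𝔭) ≤ Module.supportDim R M := by
  -- the poset `V = Supp M = V(Ann M)` and its point `a = 𝔭`
  set V : Set (PrimeSpectrum R) := Module.support R M with hV
  have hmemV : ∀ q : PrimeSpectrum R, Module.annihilator R M ≤ q.asIdeal → q ∈ V := fun q hq =>
    Module.mem_support_iff_of_finite.mpr hq
  let a : V := ⟨⟨𝔭, inferInstance⟩, hmemV _ h𝔭⟩
  -- (1) `dim Supp M_𝔭 ≤ height a`: contract primes of `R_𝔭`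
  have h1 : Module.supportDim (Localization.AtPrime 𝔭) (LocalizedModule 𝔭.primeCompl M) ≤
      (height a : ℕ∞) := by
    rw [height_eq_krullDim_Iic, Module.supportDim]
    let f : Module.support (Localization.AtPrime 𝔭) (LocalizedModule 𝔭.primeCompl M) → Set.Iic a :=
      fun q => ⟨⟨⟨q.1.asIdeal.comap (algebraMap R (Localization.AtPrime 𝔭)), inferInstance⟩,
        hmemV _ (by
          have hq : Module.annihilator (Localization.AtPrime 𝔭) (LocalizedModule 𝔭.primeCompl M) ≤
              q.1.asIdeal := Module.mem_support_iff_of_finite.mp q.2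
          exact (Ideal.map_le_iff_le_comap.mp
            ((annihilator_map_le_annihilator_localizedModule 𝔭).trans hq)))⟩,
        show (_ : PrimeSpectrum R) ≤ _ from
          (PrimeSpectrum.asIdeal_le_asIdeal _ _).mp (comap_le_of_isPrime 𝔭 q.1.asIdeal)⟩
    refine krullDim_le_of_strictMono f ?_
    intro q q' hqq'
    have hlt : q.1.asIdeal < q'.1.asIdeal := hqq'
    show (f q).1.1 < (f q').1.1
    rw [← PrimeSpectrum.asIdeal_lt_asIdeal]
    exact (IsLocalization.orderEmbedding 𝔭.primeCompl (Localization.AtPrime 𝔭)).strictMono hlt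
  -- (2) `dim R/𝔭 ≤ coheight a`: primes above `𝔭` stay in `V`
  have h2 : ringKrullDim (R ⧸ 𝔭) ≤ (coheight a : ℕ∞) := by
    rw [coheight_eq_krullDim_Ici, ringKrullDim_quotient]
    let g : PrimeSpectrum.zeroLocus (R := R) 𝔭 → Set.Ici a := fun q =>
      ⟨⟨q.1, hmemV _ (h𝔭.trans fun x hx => q.2 hx)⟩,
        show a ≤ _ from (PrimeSpectrum.asIdeal_le_asIdeal _ _).mp fun x hx => q.2 hx⟩
    refine krullDim_le_of_strictMono g fun q q' hqq' => ?_
    exact hqq'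
  -- (3) `height a + coheight a ≤ krullDim V`
  have h3 : ((height a : ℕ∞) : WithBot ℕ∞) + (coheight a : ℕ∞) ≤ Module.supportDim R M := by
    haveI : Nonempty V := ⟨a⟩
    rw [Module.supportDim, ← hV, krullDim_eq_iSup_height_add_coheight_of_nonempty, ← WithBot.coe_add,
      WithBot.coe_le_coe]
    exact le_iSup (fun b : V => height b + coheight b) a
  exact (add_le_add h1 h2).trans h3

end Literature.AlgebraicGeometry.Resolution

end
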